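import Literature.AlgebraicGeometry.Motives.HodgeLieWeilSquareRankOne
import Literature.AlgebraicGeometry.Motives.HodgeLieWeightOneLeviCornerRank
import HarnessLib

/-!
# The Weil square when every raising operator has rank ≥ 2 on `W⁻`: compression forces `N N̄ = λ` on the image, and the Hodge-degree-zero part of `Lie Hg ⊗ ℂ` still realises EVERY endomorphism of `W⁺` and of `W⁻` — brick S1 (r = 2) of the (3|3) WEIL square

Family `hodge`, layer `Literature/AlgebraicGeometry/Motives`, namespace `Literature.AlgebraicGeometry.Motives.HodgeStructure`, sub-namespace
`WeilSquare`. THEOREMS ONLY (no definition, no named fact, no `sorry`). Written for the cell `pub-hodgeav-hg6` (req-37 (A) Q2b; eng-4 g7, brick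
S1 (r = 2) of `HOME/jobs/WEIL33-eng4g7/DESIGN.md` REV 4 §7). HONEST FRAMING: nothing here proves HC / HC_AV / HC_CM; unconditional linear algebra
of Hodge structures; no step towards a summit statement.

SETTING (`Motives/HodgeThetaSubalgebraUnitary`): `H` effective polarized weight-1, `φ ∈ End_Hdg(V)`, `φ² = −d` (`d > 0`), `End_Hdg(V) = ℚ + ℚφ`,
`μ² = −d`, `W = ker(φ_ℂ − μ)`, `W⁺ = W ∩ V^{1,0}`, `W⁻ = W ∩ V^{0,1}`, both of dimension `3`; `𝔥_ℂ = hodgeLieC H`; `𝔊⁰` = the elements of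
`𝔥_ℂ` preserving `V^{1,0}` and `V^{0,1}`. HYPOTHESIS «r = 2»: every RAISING `B ∈ 𝔥_ℂ` (`B V^{1,0} = 0`, `B V_ℂ ⊆ V^{1,0}`) whose restriction
to `W⁻` has rank `≤ 1` VANISHES on `W⁻`; and a raising `N ∈ 𝔥_ℂ`, non-zero on `W⁻`, with a kernel vector `0 ≠ w₀ ∈ W⁻` (B1
`WeilSquare.exists_raising_not_injective`).

MAIN THEOREMS **`WeilSquare.exists_restrict_plus_eq_of_rankTwo`**, **`WeilSquare.exists_restrict_minus_eq_of_rankTwo`**: every endomorphism of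
`W⁺` (resp. `W⁻`) is the restriction of an element of `𝔊⁰` — the hypothesis `hproj` of `LieGoursatTwist.lift_or_twist_of_submodules` in the
r = 2 branch, WITHOUT any classification of irreducible subalgebras of `𝔤𝔩₃`. PROOF. `M := N̄ = conj ∘ N ∘ conj ∈ 𝔥_ℂ` is lowering with
`ψ_ℂ(Nx, ȳ) = −ψ_ℂ(x, conj(My))` (`M = −N†` for `H(x,y) = ψ_ℂ(x, ȳ)`); `R := [N, M]` acts on `W⁺` as `NM` and maps `W⁺` into `F := N(W⁻)`,
a plane (`dim W⁻ = 3`, kernel line `ℂw₀`; rank `1` is excluded by r = 2). (i) COMPRESSION: `NMN ∈ 𝔥_ℂ` (`NilCompression.mul_mul_mul_mem`,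
`N² = 0`), so for an eigenvalue `λ` of `R|_F` the raising element `NMN − λN` has rank `≤ 1` on `W⁻`, hence vanishes there: **`R = λ` on `F`**.
(ii) `λ ≠ 0`: otherwise `ψ_ℂ(Mf, conj(Mf)) = −ψ_ℂ(NMf, f̄) = 0` kills `M` on `F` (second Hodge–Riemann relation), and then
`ψ_ℂ(Nw, conj(Nw)) = −ψ_ℂ(w, conj(MNw)) = 0` kills `N` on `W⁻`. (iii) `E := 1 − λ⁻¹R` is an idempotent of `W⁺` killing the plane `F`, non-zero
(`F ⊊ W⁺`): a RANK-ONE IDEMPOTENT realised by `λΘ − R ∈ 𝔊⁰` up to the factor `λ` ⟹ `𝔊⁰|_{W⁺} = End(W⁺)` by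
`WeilSquare.exists_restrict_plus_eq_of_smulRight` (over `Literature.Algebra.Lie.eq_top_of_irreducible_of_smulRight_mem` and the orbit lemma S0).
(iv) On `W⁻`: `N(MNw − λw) = (R − λ)Nw = 0`, so `MNw − λw ∈ ker N ∩ W⁻ = ℂw₀`, `= γ(w) w₀` with `γ(w₀) = −λ`; `−[M,N] − λΘ ∈ 𝔊⁰` acts on `W⁻`
as `w ↦ −γ(w) w₀`, rank one with `−γ(w₀) = λ ≠ 0` ⟹ `𝔊⁰|_{W⁻} = End(W⁻)` (**`WeilSquare.exists_restrict_minus_eq_of_smulRight`**, the `W⁻` twin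
of §1 of `HodgeLieWeilSquareRankOne`). In the `𝔰𝔬₆` model `NN† = |v|²(1 − proj_v)`: r = 2 forces equal singular values.

## References

* [Gordon1997] B. B. Gordon, arXiv:alg-geom/9709030, §6 (proof of Thm. 6.3.3, pp. 18–19).
* [MoonenZarhin1999LowDim] B. Moonen, Yu. Zarhin, Math. Ann. 315 (1999), §2 (2.3), §3 proof of Lemma (3.4).
* [Deligne1982HodgeCycles] P. Deligne, LNM 900 (1982), I §3 (proof of Prop. 3.4: compression `[Z,[Z,x]]`).
-/

noncomputable section

open scoped TensorProduct

namespace Literature.AlgebraicGeometry.Motives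

namespace HodgeStructure

universe u

variable {V : Type u} [AddCommGroup V] [Module ℚ V] [Module.Finite ℚ V] [HodgeTensorFacts.{u, u}] {n : ℤ}

/-! ### §0 Plumbing: a map into a line is a functional times the generator -/

omit [Module.Finite ℚ V] [HodgeTensorFacts.{u, u}] in
/-- If `T` maps a subspace `S` into the line `ℂu` (`u ≠ 0`), then `T x = α(x) u` on `S` for a linear functional `α` on `S`. Private plumbing.
[folklore] -/
private theorem WeilSquare.exists_dual_of_mapsTo_span {T : Module.End ℂ (ℂ ⊗[ℚ] V)} {S : Submodule ℂ (ℂ ⊗[ℚ] V)} {u : ℂ ⊗[ℚ] V}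
    (hu0 : u ≠ 0) (hT : ∀ x ∈ S, T x ∈ ℂ ∙ u) : ∃ α : Module.Dual ℂ ↥S, ∀ x : ↥S, T x = α x • u := by
  refine ⟨(LinearEquiv.coord ℂ (ℂ ⊗[ℚ] V) u hu0).toLinearMap ∘ₗ
    LinearMap.codRestrict (ℂ ∙ u) (T ∘ₗ S.subtype) (fun x => hT x x.2), fun x => ?_⟩
  rw [LinearMap.comp_apply, LinearEquiv.coe_toLinearMap, LinearEquiv.coord_apply_smul]
  rfl

omit [Module.Finite ℚ V] [HodgeTensorFacts.{u, u}] in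
/-- A subspace of dimension `≤ 1` lies in a line. Private plumbing. [folklore] -/
private theorem WeilSquare.exists_le_span_of_finrank_le_one {X : Type*} [AddCommGroup X] [Module ℂ X]
    {S : Submodule ℂ X} [FiniteDimensional ℂ S] (h : Module.finrank ℂ S ≤ 1) : ∃ u : X, ∀ z ∈ S, z ∈ ℂ ∙ u := by
  by_cases hS : S = ⊥
  · exact ⟨0, fun z hz => by rw [hS, Submodule.mem_bot] at hz; rw [hz]; exact Submodule.zero_mem _⟩
  · obtain ⟨z₀, hz₀, hz₀0⟩ := (Submodule.ne_bot_iff S).1 hS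
    haveI : FiniteDimensional ℂ ↥(ℂ ∙ z₀) := inferInstance
    have hle : (ℂ ∙ z₀) ≤ S := (Submodule.span_singleton_le_iff_mem _ _).2 hz₀
    have heq : (ℂ ∙ z₀) = S := Submodule.eq_of_le_of_finrank_le hle (by rw [finrank_span_singleton hz₀0]; exact h)
    exact ⟨z₀, fun z hz => heq ▸ hz⟩

/-! ### §1 Packaging on `W⁻` (twin of `WeilSquare.exists_restrict_plus_eq_of_smulRight`) -/

set_option maxHeartbeats 800000 in
/-- **`W⁻` twin of the packaging lemma**: a `Y₀ ∈ 𝔊⁰` acting on `W⁻ = W ∩ V^{0,1}` as `w ↦ α(w) u` with `α(u) ≠ 0` makes every endomorphism of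
`W⁻` a restriction of an element of `𝔊⁰` (irreducibility by S0 `WeilSquare.eq_bot_or_eq_minus_of_stable`, then
`Literature.Algebra.Lie.eq_top_of_irreducible_of_smulRight_mem`). [cite: Gordon1997, §6 (proof of Thm. 6.3.3, p. 19)] -/
theorem WeilSquare.exists_restrict_minus_eq_of_smulRight (H : HodgeStructure V n) (hn : n = 1) (heff : H.IsEffective)
    (ψ : H.Polarization) {φ : Module.End ℚ V} (hφE : φ ∈ H.endAlg) {d : ℚ} (hd : 0 < d) (hφ2 : φ * φ = -(d • 1))
    (hE : ∀ a ∈ H.endAlg, ∃ x y : ℚ, a = x • 1 + y • φ) {μ : ℂ} (hμ : μ ^ 2 = -(d : ℂ))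
    {Y₀ : Module.End ℂ (ℂ ⊗[ℚ] V)} (hY₀ : Y₀ ∈ H.hodgeLieC) (hY₀P : ∀ p ∈ H.piece 1 0, Y₀ p ∈ H.piece 1 0)
    (hY₀Q : ∀ q ∈ H.piece 0 1, Y₀ q ∈ H.piece 0 1)
    (α : Module.Dual ℂ ↥(Module.End.eigenspace (φ.baseChange ℂ) μ ⊓ H.piece 0 1))
    (u : ↥(Module.End.eigenspace (φ.baseChange ℂ) μ ⊓ H.piece 0 1)) (hαu : α u ≠ 0)
    (hY₀W : ∀ w : ↥(Module.End.eigenspace (φ.baseChange ℂ) μ ⊓ H.piece 0 1), Y₀ w = α w • (u : ℂ ⊗[ℚ] V)) :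
    ∀ F : Module.End ℂ ↥(Module.End.eigenspace (φ.baseChange ℂ) μ ⊓ H.piece 0 1),
      ∃ Y ∈ H.hodgeLieC, (∀ p ∈ H.piece 1 0, Y p ∈ H.piece 1 0) ∧ (∀ q ∈ H.piece 0 1, Y q ∈ H.piece 0 1) ∧
        ∀ w : ↥(Module.End.eigenspace (φ.baseChange ℂ) μ ⊓ H.piece 0 1), Y w = F w := by
  classical
  have hcφ : ∀ {Y}, Y ∈ H.hodgeLieC → Y * φ.baseChange ℂ = φ.baseChange ℂ * Y := fun {Y} hY =>
    H.commute_baseChange_of_mem_hodgeLieC hY ⟨φ, hφE⟩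
  set G0 : Submodule ℂ (Module.End ℂ (ℂ ⊗[ℚ] V)) :=
    { carrier := {Y | Y ∈ H.hodgeLieC ∧ (∀ p ∈ H.piece 1 0, Y p ∈ H.piece 1 0) ∧ (∀ q ∈ H.piece 0 1, Y q ∈ H.piece 0 1)}
      zero_mem' := ⟨Submodule.zero_mem _, fun p _ => by rw [LinearMap.zero_apply]; exact Submodule.zero_mem _,
        fun q _ => by rw [LinearMap.zero_apply]; exact Submodule.zero_mem _⟩
      add_mem' := fun {Y Y'} hY hY' => ⟨Submodule.add_mem _ hY.1 hY'.1,
        fun p hp => by rw [LinearMap.add_apply]; exact Submodule.add_mem _ (hY.2.1 p hp) (hY'.2.1 p hp),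
        fun q hq => by rw [LinearMap.add_apply]; exact Submodule.add_mem _ (hY.2.2 q hq) (hY'.2.2 q hq)⟩
      smul_mem' := fun c Y hY => ⟨Submodule.smul_mem _ c hY.1,
        fun p hp => by rw [LinearMap.smul_apply]; exact Submodule.smul_mem _ c (hY.2.1 p hp),
        fun q hq => by rw [LinearMap.smul_apply]; exact Submodule.smul_mem _ c (hY.2.2 q hq)⟩ } with hG0def
  have hG0W : ∀ Y : G0, ∀ x ∈ Module.End.eigenspace (φ.baseChange ℂ) μ ⊓ H.piece 0 1,
      (Y : Module.End ℂ (ℂ ⊗[ℚ] V)) x ∈ Module.End.eigenspace (φ.baseChange ℂ) μ ⊓ H.piece 0 1 := fun Y x hx =>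
    Submodule.mem_inf.2 ⟨UnitaryTheta.apply_mem_eigenspace_of_commute (hcφ Y.2.1) (Submodule.mem_inf.1 hx).1,
      Y.2.2.2 x (Submodule.mem_inf.1 hx).2⟩
  have hG0br : ∀ Y ∈ G0, ∀ Y' ∈ G0, Y * Y' - Y' * Y ∈ G0 := fun Y hY Y' hY' =>
    ⟨H.commutator_mem_hodgeLieC hY.1 hY'.1,
      fun p hp => by
        rw [LinearMap.sub_apply, Module.End.mul_apply, Module.End.mul_apply]
        exact Submodule.sub_mem _ (hY.2.1 _ (hY'.2.1 p hp)) (hY'.2.1 _ (hY.2.1 p hp)),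
      fun q hq => by
        rw [LinearMap.sub_apply, Module.End.mul_apply, Module.End.mul_apply]
        exact Submodule.sub_mem _ (hY.2.2 _ (hY'.2.2 q hq)) (hY'.2.2 _ (hY.2.2 q hq))⟩
  set res : G0 →ₗ[ℂ] Module.End ℂ ↥(Module.End.eigenspace (φ.baseChange ℂ) μ ⊓ H.piece 0 1) :=
    { toFun := fun Y => (Y : Module.End ℂ (ℂ ⊗[ℚ] V)).restrict (hG0W Y)
      map_add' := fun Y Y' => LinearMap.ext fun w => Subtype.ext rfl
      map_smul' := fun c Y => LinearMap.ext fun w => Subtype.ext rfl } with hres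
  have hresapply : ∀ (Y : G0) (w : ↥(Module.End.eigenspace (φ.baseChange ℂ) μ ⊓ H.piece 0 1)),
      ((res Y w : ↥(Module.End.eigenspace (φ.baseChange ℂ) μ ⊓ H.piece 0 1)) : ℂ ⊗[ℚ] V) =
        (Y : Module.End ℂ (ℂ ⊗[ℚ] V)) w := fun Y w => rfl
  set 𝔏 : Submodule ℂ (Module.End ℂ ↥(Module.End.eigenspace (φ.baseChange ℂ) μ ⊓ H.piece 0 1)) := LinearMap.range res
    with h𝔏def
  have h𝔏br : ∀ A ∈ 𝔏, ∀ B ∈ 𝔏, A * B - B * A ∈ 𝔏 := by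
    rintro _ ⟨Y, rfl⟩ _ ⟨Y', rfl⟩
    refine ⟨⟨(Y : Module.End ℂ (ℂ ⊗[ℚ] V)) * (Y' : Module.End ℂ (ℂ ⊗[ℚ] V)) -
        (Y' : Module.End ℂ (ℂ ⊗[ℚ] V)) * (Y : Module.End ℂ (ℂ ⊗[ℚ] V)), hG0br Y Y.2 Y' Y'.2⟩, LinearMap.ext fun w => Subtype.ext ?_⟩
    simp only [hresapply, LinearMap.sub_apply, Module.End.mul_apply, Submodule.coe_sub]
  have h𝔏irr : ∀ U : Submodule ℂ ↥(Module.End.eigenspace (φ.baseChange ℂ) μ ⊓ H.piece 0 1),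
      (∀ A ∈ 𝔏, ∀ x ∈ U, A x ∈ U) → U = ⊥ ∨ U = ⊤ := by
    intro U hU
    set U₀ : Submodule ℂ (ℂ ⊗[ℚ] V) := U.map (Module.End.eigenspace (φ.baseChange ℂ) μ ⊓ H.piece 0 1).subtype with hU₀
    have hU₀le : U₀ ≤ Module.End.eigenspace (φ.baseChange ℂ) μ ⊓ H.piece 0 1 := by
      rintro _ ⟨x, -, rfl⟩; exact x.2
    have hU₀st : ∀ Y ∈ H.hodgeLieC, (∀ p ∈ H.piece 1 0, Y p ∈ H.piece 1 0) → (∀ q ∈ H.piece 0 1, Y q ∈ H.piece 0 1) →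
        ∀ x ∈ U₀, Y x ∈ U₀ := by
      rintro Y hY hYP hYQ _ ⟨x, hx, rfl⟩
      have h := hU (res ⟨Y, hY, hYP, hYQ⟩) (LinearMap.mem_range_self res _) x hx
      exact ⟨_, h, rfl⟩
    rcases WeilSquare.eq_bot_or_eq_minus_of_stable H hn heff ψ hφE hd hφ2 hE hμ U₀ hU₀le hU₀st with h | h
    · left
      rw [eq_bot_iff]
      intro x hx
      have hx0 : (x : ℂ ⊗[ℚ] V) ∈ U₀ := ⟨x, hx, rfl⟩
      rw [h, Submodule.mem_bot] at hx0
      rw [Submodule.mem_bot]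
      exact Subtype.ext hx0
    · right
      apply Submodule.map_injective_of_injective (Module.End.eigenspace (φ.baseChange ℂ) μ ⊓ H.piece 0 1).injective_subtype
      rw [Submodule.map_subtype_top]
      exact h
  have hP : α.smulRight u ∈ 𝔏 := by
    refine ⟨⟨Y₀, hY₀, hY₀P, hY₀Q⟩, LinearMap.ext fun w => Subtype.ext ?_⟩
    rw [hresapply, LinearMap.smulRight_apply, Submodule.coe_smul]
    exact hY₀W w
  have htop := Literature.Algebra.Lie.eq_top_of_irreducible_of_smulRight_mem h𝔏br h𝔏irr hP hαu
  intro F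
  have hF : F ∈ 𝔏 := htop ▸ Submodule.mem_top
  obtain ⟨Y, hY⟩ := hF
  refine ⟨Y, Y.2.1, Y.2.2.1, Y.2.2.2, fun w => ?_⟩
  rw [← hY, hresapply]

/-! ### §2 r = 2: compression forces `N N̄ = λ` on `N(W⁻)`, and both restrictions of `𝔊⁰` are everything -/

set_option maxHeartbeats 3200000 in
/-- **The core of the r = 2 analysis.** With `M = N̄` and `R = [N, M]`: there is `λ ≠ 0` with `R(Nw) = λ Nw` for all `w ∈ W⁻`, `R(W⁺) ⊆ N(W⁻)`,
`M(W⁺) ⊆ W⁻`, the adjunction `ψ_ℂ(Nx, ȳ) = −ψ_ℂ(x, conj(My))`, `N(W⁻)` is a plane, and there is `p₁ ∈ W⁺` with `R p₁ ≠ λ p₁` (compression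
`NMN ∈ 𝔥_ℂ`, an eigenvalue of `R` on the plane `N(W⁻)`, the hypothesis r = 2, and the second Hodge–Riemann relation).
[cite: Deligne1982HodgeCycles, I §3 (proof of Prop. 3.4)] [cite: MoonenZarhin1999LowDim, §2 (2.3)] -/
theorem WeilSquare.exists_eigenvalue_of_rankTwo (H : HodgeStructure V n) (hn : n = 1) (heff : H.IsEffective)
    (ψ : H.Polarization) {φ : Module.End ℚ V} (hφE : φ ∈ H.endAlg) {d : ℚ} (hd : 0 < d) {μ : ℂ} (hμ : μ ^ 2 = -(d : ℂ))
    (hWp : Module.finrank ℂ ↥(Module.End.eigenspace (φ.baseChange ℂ) μ ⊓ H.piece 1 0) = 3)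
    (hWm : Module.finrank ℂ ↥(Module.End.eigenspace (φ.baseChange ℂ) μ ⊓ H.piece 0 1) = 3)
    {N : Module.End ℂ (ℂ ⊗[ℚ] V)} (hN : N ∈ H.hodgeLieC) (hNP : ∀ p ∈ H.piece 1 0, N p = 0) (hNim : ∀ v, N v ∈ H.piece 1 0)
    {w₀ : ℂ ⊗[ℚ] V} (hw₀ : w₀ ∈ Module.End.eigenspace (φ.baseChange ℂ) μ ⊓ H.piece 0 1) (hw₀0 : w₀ ≠ 0) (hNw₀ : N w₀ = 0)
    (hN0 : ∃ w ∈ Module.End.eigenspace (φ.baseChange ℂ) μ ⊓ H.piece 0 1, N w ≠ 0)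
    (hr2 : ∀ B ∈ H.hodgeLieC, (∀ p ∈ H.piece 1 0, B p = 0) → (∀ v, B v ∈ H.piece 1 0) →
      (∃ u : ℂ ⊗[ℚ] V, ∀ w ∈ Module.End.eigenspace (φ.baseChange ℂ) μ ⊓ H.piece 0 1, B w ∈ ℂ ∙ u) →
      ∀ w ∈ Module.End.eigenspace (φ.baseChange ℂ) μ ⊓ H.piece 0 1, B w = 0)
    {M : Module.End ℂ (ℂ ⊗[ℚ] V)} (hM : ∀ v, M v = conj (N (conj v))) :
    ∃ lam : ℂ, lam ≠ 0 ∧ M ∈ H.hodgeLieC ∧ (∀ q ∈ H.piece 0 1, M q = 0) ∧ (∀ v, M v ∈ H.piece 0 1) ∧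
      (∀ p ∈ Module.End.eigenspace (φ.baseChange ℂ) μ ⊓ H.piece 1 0, M p ∈ Module.End.eigenspace (φ.baseChange ℂ) μ ⊓ H.piece 0 1) ∧
      (∀ x y, ψ.form.baseChange ℂ (N x) (conj y) = -ψ.form.baseChange ℂ x (conj (M y))) ∧
      (∀ w ∈ Module.End.eigenspace (φ.baseChange ℂ) μ ⊓ H.piece 0 1, N (M (N w)) = lam • N w) ∧
      (∀ w ∈ Module.End.eigenspace (φ.baseChange ℂ) μ ⊓ H.piece 0 1,
        N w ∈ Module.End.eigenspace (φ.baseChange ℂ) μ ⊓ H.piece 1 0) ∧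
      Module.finrank ℂ ↥((Module.End.eigenspace (φ.baseChange ℂ) μ ⊓ H.piece 0 1).map N) = 2 ∧
      (∀ w ∈ Module.End.eigenspace (φ.baseChange ℂ) μ ⊓ H.piece 0 1, N w = 0 → w ∈ ℂ ∙ w₀) := by
  classical
  subst hn
  set W := Module.End.eigenspace (φ.baseChange ℂ) μ with hWdef
  set Wp := W ⊓ H.piece 1 0 with hWpdef
  set Wm := W ⊓ H.piece 0 1 with hWmdef
  set ψC := ψ.form.baseChange ℂ with hψC
  obtain ⟨hμ0, hμc⟩ := UnitaryTheta.conj_eq_neg_of_sq hd hμ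
  have hcφ : ∀ {Y}, Y ∈ H.hodgeLieC → Y * φ.baseChange ℂ = φ.baseChange ℂ * Y := fun {Y} hY =>
    H.commute_baseChange_of_mem_hodgeLieC hY ⟨φ, hφE⟩
  have hYW : ∀ {Y}, Y ∈ H.hodgeLieC → ∀ w ∈ W, Y w ∈ W := fun {Y} hY w hw =>
    UnitaryTheta.apply_mem_eigenspace_of_commute (hcφ hY) hw
  have hPQ : ∀ x ∈ H.piece 1 0, conj x ∈ H.piece 0 1 := fun x hx => conj_mem_piece H hx
  have hQP : ∀ x ∈ H.piece 0 1, conj x ∈ H.piece 1 0 := fun x hx => conj_mem_piece H hx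
  have hcW : ∀ x ∈ W, conj x ∈ Module.End.eigenspace (φ.baseChange ℂ) (-μ) := fun x hx =>
    (UnitaryTheta.conj_mem_eigenspace_iff φ hμc x).2 hx
  have hcWbar : ∀ x ∈ Module.End.eigenspace (φ.baseChange ℂ) (-μ), conj x ∈ W := fun x hx =>
    (UnitaryTheta.conj_mem_eigenspace_iff' φ hμc x).2 hx
  -- `M = N̄`
  have hM𝔥 : M ∈ H.hodgeLieC := by
    rw [hodgeLieC_eq_spanC] at hN ⊢
    exact conjOp_mem_spanC hN hM
  have hMQ : ∀ q ∈ H.piece 0 1, M q = 0 := fun q hq => by rw [hM, hNP _ (hQP q hq), map_zero]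
  have hMim : ∀ v, M v ∈ H.piece 0 1 := fun v => by rw [hM]; exact hPQ _ (hNim _)
  have hMWp : ∀ p ∈ Wp, M p ∈ Wm := fun p hp => by
    refine Submodule.mem_inf.2 ⟨?_, hMim p⟩
    rw [hM]
    exact hcWbar _ (UnitaryTheta.apply_mem_eigenspace_of_commute (hcφ hN) (hcW p (Submodule.mem_inf.1 hp).1))
  have hNWm : ∀ w ∈ Wm, N w ∈ Wp := fun w hw => Submodule.mem_inf.2 ⟨hYW hN w (Submodule.mem_inf.1 hw).1, hNim w⟩
  have hskewN : ∀ x y, ψC (N x) y = -ψC x (N y) := fun x y => formBaseChange_skew_of_mem_hodgeLieC ψ hN x y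
  have hadj : ∀ x y, ψC (N x) (conj y) = -ψC x (conj (M y)) := fun x y => by rw [hskewN, hM, conj_conj]
  have hcast : ((((1 : ℤ).negOnePow : ℤˣ) : ℤ) : ℂ) ≠ 0 := Int.cast_ne_zero.2 (Units.ne_zero _)
  have hHR : ∀ {x : ℂ ⊗[ℚ] V} {p q : ℤ}, p + q = 1 → x ∈ H.piece p q → ψC x (conj x) = 0 → x = 0 := by
    intro x p q hpq hx h0
    by_contra hx0
    exact ψ.form_conj_ne_zero hpq hx hx0 h0
  -- `N² = 0`, compression
  have hNN : N * N = 0 := LinearMap.ext fun v => by rw [Module.End.mul_apply, hNP _ (hNim v), LinearMap.zero_apply]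
  have hbrC : ∀ Y ∈ H.hodgeLieC, ∀ Z ∈ H.hodgeLieC, Y * Z - Z * Y ∈ H.hodgeLieC := fun Y hY Z hZ => H.commutator_mem_hodgeLieC hY hZ
  have hNMN : N * M * N ∈ H.hodgeLieC := NilCompression.mul_mul_mul_mem hbrC hN hNN hM𝔥
  -- `R := N M` on `W⁺`, `F := N(W⁻)`
  set F : Submodule ℂ (ℂ ⊗[ℚ] V) := Wm.map N with hFdef
  have hFWp : F ≤ Wp := by
    rintro _ ⟨w, hw, rfl⟩; exact hNWm w hw
  have hRF : ∀ f ∈ F, N (M f) ∈ F := fun f hf => ⟨M f, hMWp f (hFWp hf), rfl⟩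
  -- `dim F ≤ 2` (kernel vector `w₀`) and `F ≠ 0`
  have hFle : Module.finrank ℂ F ≤ 2 := by
    have h := LinearMap.finrank_range_add_finrank_ker (N.domRestrict Wm)
    rw [LinearMap.range_domRestrict, ← hFdef, hWm] at h
    have hker : 1 ≤ Module.finrank ℂ ↥(LinearMap.ker (N.domRestrict Wm)) := by
      have hmem : (⟨w₀, hw₀⟩ : Wm) ∈ LinearMap.ker (N.domRestrict Wm) := by
        rw [LinearMap.mem_ker, LinearMap.domRestrict_apply]; exact hNw₀
      have hne : LinearMap.ker (N.domRestrict Wm) ≠ ⊥ := fun h0 => by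
        rw [h0, Submodule.mem_bot] at hmem
        exact hw₀0 (congrArg Subtype.val hmem)
      exact Nat.one_le_iff_ne_zero.2 fun h0 => hne (Submodule.finrank_eq_zero.1 h0)
    omega
  obtain ⟨w₁, hw₁, hNw₁⟩ := hN0
  have hF0 : F ≠ ⊥ := fun h => hNw₁ (by
    have hmem : N w₁ ∈ F := ⟨w₁, hw₁, rfl⟩
    rw [h, Submodule.mem_bot] at hmem
    exact hmem)
  -- (i) an eigenvalue of `R` on `F`, and `R = λ` on `F` by r = 2
  set RF : Module.End ℂ ↥F := (N * M).restrict (fun f hf => by rw [Module.End.mul_apply]; exact hRF f hf) with hRFdef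
  haveI : Nontrivial ↥F := Submodule.nontrivial_iff_ne_bot.2 hF0
  obtain ⟨lam, hlam⟩ := Module.End.exists_eigenvalue RF
  obtain ⟨f₀, hf₀⟩ := hlam.exists_hasEigenvector
  have hf₀eq : N (M (f₀ : ℂ ⊗[ℚ] V)) = lam • (f₀ : ℂ ⊗[ℚ] V) := by
    have h := congrArg Subtype.val (Module.End.mem_eigenspace_iff.1 hf₀.1)
    rw [hRFdef, LinearMap.restrict_apply] at h
    simpa [Module.End.mul_apply] using h
  have hf₀0 : (f₀ : ℂ ⊗[ℚ] V) ≠ 0 := fun h => hf₀.2 (Subtype.ext h)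
  -- the raising element `B = NMN − λN`
  set B := N * M * N - lam • N with hBdef
  have hB𝔥 : B ∈ H.hodgeLieC := Submodule.sub_mem _ hNMN (Submodule.smul_mem _ _ hN)
  have hBP : ∀ p ∈ H.piece 1 0, B p = 0 := fun p hp => by
    rw [hBdef, LinearMap.sub_apply, LinearMap.smul_apply, Module.End.mul_apply, Module.End.mul_apply, hNP p hp, map_zero, map_zero,
      smul_zero, sub_zero]
  have hBim : ∀ v, B v ∈ H.piece 1 0 := fun v => by
    rw [hBdef, LinearMap.sub_apply, LinearMap.smul_apply, Module.End.mul_apply, Module.End.mul_apply]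
    exact Submodule.sub_mem _ (hNim _) (Submodule.smul_mem _ _ (hNim _))
  have hBapply : ∀ w, B w = N (M (N w)) - lam • N w := fun w => by
    rw [hBdef, LinearMap.sub_apply, LinearMap.smul_apply, Module.End.mul_apply, Module.End.mul_apply]
  -- `B|_{W⁻}` has rank `≤ 1`: its values lie in the range of `RF − λ` which has a kernel vector on the (≤ 2)-dimensional `F`
  have hBrank : ∃ u : ℂ ⊗[ℚ] V, ∀ w ∈ Wm, B w ∈ ℂ ∙ u := by
    set T := RF - lam • 1 with hTdef
    have hTf₀ : T f₀ = 0 := by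
      rw [hTdef, LinearMap.sub_apply, LinearMap.smul_apply, Module.End.one_apply, Module.End.mem_eigenspace_iff.1 hf₀.1, sub_self]
    have hrange : Module.finrank ℂ ↥(LinearMap.range T) ≤ 1 := by
      have h := LinearMap.finrank_range_add_finrank_ker T
      have hker : 1 ≤ Module.finrank ℂ ↥(LinearMap.ker T) := by
        have hne : LinearMap.ker T ≠ ⊥ := fun h0 => by
          have hmem : f₀ ∈ LinearMap.ker T := LinearMap.mem_ker.2 hTf₀
          rw [h0, Submodule.mem_bot] at hmem
          exact hf₀.2 hmem
        exact Nat.one_le_iff_ne_zero.2 fun h0 => hne (Submodule.finrank_eq_zero.1 h0)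
      omega
    obtain ⟨v, hv⟩ := WeilSquare.exists_le_span_of_finrank_le_one hrange
    refine ⟨((v : ↥F) : ℂ ⊗[ℚ] V), fun w hw => ?_⟩
    have hmem : T ⟨N w, ⟨w, hw, rfl⟩⟩ ∈ LinearMap.range T := LinearMap.mem_range_self T _
    obtain ⟨c, hc⟩ := Submodule.mem_span_singleton.1 (hv _ hmem)
    have hval : (T ⟨N w, ⟨w, hw, rfl⟩⟩ : ℂ ⊗[ℚ] V) = B w := by
      simp only [hTdef, hRFdef, LinearMap.sub_apply, LinearMap.smul_apply, Module.End.one_apply, Submodule.coe_sub,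
        Submodule.coe_smul, LinearMap.coe_restrict_apply, Module.End.mul_apply, hBapply]
    refine Submodule.mem_span_singleton.2 ⟨c, ?_⟩
    have h := congrArg (fun z : ↥F => (z : ℂ ⊗[ℚ] V)) hc
    simp only [SetLike.val_smul] at h
    rw [hval] at h
    exact h
  have hB0 : ∀ w ∈ Wm, B w = 0 := hr2 B hB𝔥 hBP hBim hBrank
  have hRlam : ∀ w ∈ Wm, N (M (N w)) = lam • N w := fun w hw => by
    have h := hB0 w hw
    rw [hBapply, sub_eq_zero] at h
    exact h
  -- (ii) `λ ≠ 0`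
  have hlam0 : lam ≠ 0 := by
    intro h0
    -- `M` kills `F`
    have hMF : ∀ w ∈ Wm, M (N w) = 0 := by
      intro w hw
      have h1 : ψC (N (M (N w))) (conj (N w)) = -ψC (M (N w)) (conj (M (N w))) := hadj _ _
      rw [hRlam w hw, h0, zero_smul, LinearMap.map_zero, LinearMap.zero_apply, eq_comm, neg_eq_zero] at h1
      exact hHR (p := 0) (q := 1) (by norm_num) (hMim _) h1
    -- then `N` kills `W⁻`
    have hNWm0 : ∀ w ∈ Wm, N w = 0 := by
      intro w hw
      have h1 : ψC (N w) (conj (N w)) = -ψC w (conj (M (N w))) := hadj _ _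
      rw [hMF w hw, map_zero, map_zero, neg_zero] at h1
      exact hHR (p := 1) (q := 0) (by norm_num) (hNim _) h1
    exact hNw₁ (hNWm0 w₁ hw₁)
  -- `dim F = 2`: rank `≤ 1` would make `N` itself vanish on `W⁻`
  have hF2 : Module.finrank ℂ F = 2 := by
    rcases Nat.lt_or_ge (Module.finrank ℂ F) 2 with hlt | hge
    · exfalso
      have h1 : Module.finrank ℂ F ≤ 1 := by omega
      obtain ⟨v, hv⟩ := WeilSquare.exists_le_span_of_finrank_le_one h1
      have hN0' := hr2 N hN hNP hNim ⟨v, fun w hw => hv _ ⟨w, hw, rfl⟩⟩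
      exact hNw₁ (hN0' w₁ hw₁)
    · exact le_antisymm hFle hge
  -- (iii) `R ≠ λ` on `W⁺`
  have hp₁ : ∃ p₁ ∈ Wp, N (M p₁) ≠ lam • p₁ := by
    by_contra hall
    push Not at hall
    have hle : Wp ≤ F := fun p hp => by
      have h : p = lam⁻¹ • N (M p) := by rw [hall p hp, smul_smul, inv_mul_cancel₀ hlam0, one_smul]
      rw [h]
      exact Submodule.smul_mem _ _ ⟨M p, hMWp p hp, rfl⟩
    have h := Submodule.finrank_mono hle
    rw [hWp, hF2] at h
    omega
  -- kernel of `N` on `W⁻` is the line `ℂ w₀`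
  have hker : ∀ w ∈ Wm, N w = 0 → w ∈ ℂ ∙ w₀ := by
    intro w hw hNw
    set Kr : Submodule ℂ ↥Wm := LinearMap.ker (N.domRestrict Wm) with hKr
    have hdimK : Module.finrank ℂ Kr = 1 := by
      have h := LinearMap.finrank_range_add_finrank_ker (N.domRestrict Wm)
      rw [LinearMap.range_domRestrict, ← hFdef, hWm, hF2, ← hKr] at h
      omega
    have hw₀K : (⟨w₀, hw₀⟩ : Wm) ∈ Kr := by rw [hKr, LinearMap.mem_ker, LinearMap.domRestrict_apply]; exact hNw₀
    have hwK : (⟨w, hw⟩ : Wm) ∈ Kr := by rw [hKr, LinearMap.mem_ker, LinearMap.domRestrict_apply]; exact hNw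
    have hline : (ℂ ∙ (⟨w₀, hw₀⟩ : Wm)) = Kr := by
      refine Submodule.eq_of_le_of_finrank_le ((Submodule.span_singleton_le_iff_mem _ _).2 hw₀K) ?_
      rw [hdimK, finrank_span_singleton]
      exact fun h => hw₀0 (congrArg Subtype.val h)
    rw [← hline] at hwK
    obtain ⟨c, hc⟩ := Submodule.mem_span_singleton.1 hwK
    exact Submodule.mem_span_singleton.2 ⟨c, by simpa using congrArg Subtype.val hc⟩
  exact ⟨lam, hlam0, hM𝔥, hMQ, hMim, hMWp, hadj, hRlam, hNWm, hF2, hker⟩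

set_option maxHeartbeats 1600000 in
/-- **r = 2 ⟹ `𝔊⁰|_{W⁺} = End(W⁺)`.** Under the r = 2 hypothesis, with a raising `N ∈ 𝔥_ℂ` non-zero on `W⁻` having a kernel vector there and
`dim W^± = 3`: every endomorphism of `W⁺` is the restriction of an element of `𝔥_ℂ` preserving `V^{1,0}`, `V^{0,1}` (`λΘ − [N, N̄]` restricts to
`λ` times a rank-one idempotent; `WeilSquare.exists_restrict_plus_eq_of_smulRight`). [cite: MoonenZarhin1999LowDim, §2 (2.3) and §3 proof of Lemma (3.4)]
[cite: Gordon1997, §6 (proof of Thm. 6.3.3, pp. 18–19)] -/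
theorem WeilSquare.exists_restrict_plus_eq_of_rankTwo (H : HodgeStructure V n) (hn : n = 1) (heff : H.IsEffective)
    (ψ : H.Polarization) {φ : Module.End ℚ V} (hφE : φ ∈ H.endAlg) {d : ℚ} (hd : 0 < d) (hφ2 : φ * φ = -(d • 1))
    (hE : ∀ a ∈ H.endAlg, ∃ x y : ℚ, a = x • 1 + y • φ) {μ : ℂ} (hμ : μ ^ 2 = -(d : ℂ))
    (hWp : Module.finrank ℂ ↥(Module.End.eigenspace (φ.baseChange ℂ) μ ⊓ H.piece 1 0) = 3)
    (hWm : Module.finrank ℂ ↥(Module.End.eigenspace (φ.baseChange ℂ) μ ⊓ H.piece 0 1) = 3)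
    {N : Module.End ℂ (ℂ ⊗[ℚ] V)} (hN : N ∈ H.hodgeLieC) (hNP : ∀ p ∈ H.piece 1 0, N p = 0) (hNim : ∀ v, N v ∈ H.piece 1 0)
    {w₀ : ℂ ⊗[ℚ] V} (hw₀ : w₀ ∈ Module.End.eigenspace (φ.baseChange ℂ) μ ⊓ H.piece 0 1) (hw₀0 : w₀ ≠ 0) (hNw₀ : N w₀ = 0)
    (hN0 : ∃ w ∈ Module.End.eigenspace (φ.baseChange ℂ) μ ⊓ H.piece 0 1, N w ≠ 0)
    (hr2 : ∀ B ∈ H.hodgeLieC, (∀ p ∈ H.piece 1 0, B p = 0) → (∀ v, B v ∈ H.piece 1 0) →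
      (∃ u : ℂ ⊗[ℚ] V, ∀ w ∈ Module.End.eigenspace (φ.baseChange ℂ) μ ⊓ H.piece 0 1, B w ∈ ℂ ∙ u) →
      ∀ w ∈ Module.End.eigenspace (φ.baseChange ℂ) μ ⊓ H.piece 0 1, B w = 0) :
    ∀ F : Module.End ℂ ↥(Module.End.eigenspace (φ.baseChange ℂ) μ ⊓ H.piece 1 0),
      ∃ Y ∈ H.hodgeLieC, (∀ p ∈ H.piece 1 0, Y p ∈ H.piece 1 0) ∧ (∀ q ∈ H.piece 0 1, Y q ∈ H.piece 0 1) ∧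
        ∀ p : ↥(Module.End.eigenspace (φ.baseChange ℂ) μ ⊓ H.piece 1 0), Y p = F p := by
  classical
  obtain ⟨M, hMconj⟩ := exists_conjOp N
  obtain ⟨lam, hlam0, hM𝔥, hMQ, hMim, hMWp, -, hRlam, hNWm, hF2, -⟩ :=
    WeilSquare.exists_eigenvalue_of_rankTwo H hn heff ψ hφE hd hμ hWp hWm hN hNP hNim hw₀ hw₀0 hNw₀ hN0 hr2 hMconj
  subst hn
  obtain ⟨Θ, hΘ⟩ := exists_hodgeTheta H
  obtain ⟨hPmem, hQmem, hΘ10, hΘ01, -⟩ := UnitaryTheta.theta_facts H rfl heff hΘ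
  have hΘ𝔥 : Θ ∈ H.hodgeLieC := H.mem_hodgeLieC_of_forall_piece hΘ
  set Wp := Module.End.eigenspace (φ.baseChange ℂ) μ ⊓ H.piece 1 0 with hWpdef
  set Wm := Module.End.eigenspace (φ.baseChange ℂ) μ ⊓ H.piece 0 1 with hWmdef
  -- `Y₀ := λΘ − [N, M]`
  set R := N * M - M * N with hRdef
  set Y₀ := lam • Θ - R with hY₀def
  have hR𝔥 : R ∈ H.hodgeLieC := H.commutator_mem_hodgeLieC hN hM𝔥
  have hY₀𝔥 : Y₀ ∈ H.hodgeLieC := Submodule.sub_mem _ (Submodule.smul_mem _ _ hΘ𝔥) hR𝔥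
  have hRp : ∀ p ∈ H.piece 1 0, R p = N (M p) := fun p hp => by
    rw [hRdef, LinearMap.sub_apply, Module.End.mul_apply, Module.End.mul_apply, hNP p hp, map_zero, sub_zero]
  have hY₀P : ∀ p ∈ H.piece 1 0, Y₀ p ∈ H.piece 1 0 := fun p hp => by
    rw [hY₀def, LinearMap.sub_apply, LinearMap.smul_apply, hΘ10 p hp, hRp p hp]
    exact Submodule.sub_mem _ (Submodule.smul_mem _ _ hp) (hNim _)
  have hY₀Q : ∀ q ∈ H.piece 0 1, Y₀ q ∈ H.piece 0 1 := fun q hq => by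
    rw [hY₀def, LinearMap.sub_apply, LinearMap.smul_apply, hΘ01 q hq, hRdef, LinearMap.sub_apply, Module.End.mul_apply,
      Module.End.mul_apply, hMQ q hq, map_zero, zero_sub, sub_neg_eq_add]
    exact Submodule.add_mem _ (Submodule.smul_mem _ _ (Submodule.neg_mem _ hq)) (hMim _)
  -- `E := p ↦ p − λ⁻¹ N M p` maps `W⁺` into a line `ℂ u` (idempotent killing the plane `F`)
  set Eop : Module.End ℂ (ℂ ⊗[ℚ] V) := 1 - lam⁻¹ • (N * M) with hEdef
  have hEapply : ∀ p, Eop p = p - lam⁻¹ • N (M p) := fun p => by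
    rw [hEdef, LinearMap.sub_apply, Module.End.one_apply, LinearMap.smul_apply, Module.End.mul_apply]
  have hEF : ∀ w ∈ Wm, Eop (N w) = 0 := fun w hw => by
    rw [hEapply, hRlam w hw, smul_smul, inv_mul_cancel₀ hlam0, one_smul, sub_self]
  have hEWp : ∀ p ∈ Wp, Eop p ∈ Wp := fun p hp => by
    rw [hEapply]
    exact Submodule.sub_mem _ hp (Submodule.smul_mem _ _ (hNWm _ (hMWp p hp)))
  have hEE : ∀ p ∈ Wp, Eop (Eop p) = Eop p := fun p hp => by
    have h1 : Eop p = p - lam⁻¹ • N (M p) := hEapply p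
    rw [h1, map_sub, map_smul, hEF _ (hMWp p hp), smul_zero, sub_zero, h1]
  obtain ⟨p₁, hp₁, hp₁ne⟩ : ∃ p₁ ∈ Wp, N (M p₁) ≠ lam • p₁ := by
    -- if `NM = λ` on `W⁺` then `W⁺ ⊆ F`, impossible
    by_contra hall
    push Not at hall
    have hle : Wp ≤ Wm.map N := fun p hp => by
      have h : p = lam⁻¹ • N (M p) := by rw [hall p hp, smul_smul, inv_mul_cancel₀ hlam0, one_smul]
      rw [h]
      exact Submodule.smul_mem _ _ ⟨M p, hMWp p hp, rfl⟩
    have h := Submodule.finrank_mono hle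
    rw [hWp, hF2] at h
    omega
  set u := Eop p₁ with hudef
  have huWp : u ∈ Wp := hEWp p₁ hp₁
  have hu0 : u ≠ 0 := by
    intro h
    rw [hudef, hEapply, sub_eq_zero] at h
    have h2 := congrArg (fun z => lam • z) h
    simp only [smul_smul, mul_inv_cancel₀ hlam0, one_smul] at h2
    exact hp₁ne h2.symm
  -- the range of `E` on `W⁺` is the line `ℂ u`: it is a subspace of dimension `≤ 3 − 2 = 1` containing `u`
  have hEline : ∀ p ∈ Wp, Eop p ∈ ℂ ∙ u := by
    set T : Module.End ℂ ↥Wp := Eop.restrict hEWp with hTdef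
    have hker : 2 ≤ Module.finrank ℂ ↥(LinearMap.ker T) := by
      -- `F ⊆ ker`
      have hle : (Wm.map N).comap Wp.subtype ≤ LinearMap.ker T := by
        rintro ⟨x, hx⟩ hxF
        obtain ⟨w, hw, hwx⟩ := hxF
        rw [LinearMap.mem_ker]
        apply Subtype.ext
        have hwx' : N w = x := hwx
        change Eop x = 0
        rw [← hwx']; exact hEF w hw
      have h := Submodule.finrank_mono hle
      have hcomap : Module.finrank ℂ ↥((Wm.map N).comap Wp.subtype) = 2 := by
        rw [← hF2]
        exact LinearEquiv.finrank_eq (Submodule.comapSubtypeEquivOfLe (fun x hx => by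
          obtain ⟨w, hw, rfl⟩ := hx; exact hNWm w hw))
      omega
    have hrange : Module.finrank ℂ ↥(LinearMap.range T) ≤ 1 := by
      have h := LinearMap.finrank_range_add_finrank_ker T
      rw [hWp] at h
      omega
    have huT : (⟨u, huWp⟩ : Wp) ∈ LinearMap.range T := ⟨⟨p₁, hp₁⟩, Subtype.ext rfl⟩
    have hline : (ℂ ∙ (⟨u, huWp⟩ : Wp)) = LinearMap.range T := by
      refine Submodule.eq_of_le_of_finrank_le ((Submodule.span_singleton_le_iff_mem _ _).2 huT) ?_
      rw [finrank_span_singleton]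
      · exact hrange
      · exact fun h => hu0 (congrArg Subtype.val h)
    intro p hp
    have hmem : T ⟨p, hp⟩ ∈ LinearMap.range T := LinearMap.mem_range_self T _
    rw [← hline] at hmem
    obtain ⟨c, hc⟩ := Submodule.mem_span_singleton.1 hmem
    exact Submodule.mem_span_singleton.2 ⟨c, by simpa [hTdef, LinearMap.coe_restrict_apply] using congrArg Subtype.val hc⟩
  obtain ⟨α, hα⟩ := WeilSquare.exists_dual_of_mapsTo_span (S := Wp) hu0 hEline
  have hαu : α ⟨u, huWp⟩ = 1 := by
    have h := hα ⟨u, huWp⟩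
    have hEu : Eop u = u := by rw [hudef]; exact hEE p₁ hp₁
    simp only at h
    rw [hEu] at h
    have h1 : (α ⟨u, huWp⟩ - 1) • u = 0 := by rw [sub_smul, one_smul, ← h, sub_self]
    exact sub_eq_zero.1 ((smul_eq_zero.1 h1).resolve_right hu0)
  -- `Y₀ p = λ E p = (λ α p) u` on `W⁺`
  refine WeilSquare.exists_restrict_plus_eq_of_smulRight H rfl heff ψ hφE hd hφ2 hE hμ hY₀𝔥 hY₀P hY₀Q (lam • α) ⟨u, huWp⟩
    (by rw [LinearMap.smul_apply, hαu, smul_eq_mul, mul_one]; exact hlam0) fun p => ?_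
  have hp := p.2
  rw [hY₀def, LinearMap.sub_apply, LinearMap.smul_apply, hΘ10 _ (Submodule.mem_inf.1 hp).2, hRp _ (Submodule.mem_inf.1 hp).2,
    LinearMap.smul_apply, smul_eq_mul, mul_smul, ← hα p, hEapply, smul_sub, smul_smul, mul_inv_cancel₀ hlam0, one_smul]

set_option maxHeartbeats 1600000 in
/-- **r = 2 ⟹ `𝔊⁰|_{W⁻} = End(W⁻)`.** Same hypotheses; `−[M, N] − λΘ` acts on `W⁻` as `w ↦ −γ(w) w₀` with `−γ(w₀) = λ ≠ 0`, where
`MNw − λw = γ(w) w₀` (`N(MNw − λw) = 0` and `ker N ∩ W⁻ = ℂw₀`); then `WeilSquare.exists_restrict_minus_eq_of_smulRight`.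
[cite: MoonenZarhin1999LowDim, §2 (2.3) and §3 proof of Lemma (3.4)] [cite: Gordon1997, §6 (proof of Thm. 6.3.3, pp. 18–19)] -/
theorem WeilSquare.exists_restrict_minus_eq_of_rankTwo (H : HodgeStructure V n) (hn : n = 1) (heff : H.IsEffective)
    (ψ : H.Polarization) {φ : Module.End ℚ V} (hφE : φ ∈ H.endAlg) {d : ℚ} (hd : 0 < d) (hφ2 : φ * φ = -(d • 1))
    (hE : ∀ a ∈ H.endAlg, ∃ x y : ℚ, a = x • 1 + y • φ) {μ : ℂ} (hμ : μ ^ 2 = -(d : ℂ))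
    (hWp : Module.finrank ℂ ↥(Module.End.eigenspace (φ.baseChange ℂ) μ ⊓ H.piece 1 0) = 3)
    (hWm : Module.finrank ℂ ↥(Module.End.eigenspace (φ.baseChange ℂ) μ ⊓ H.piece 0 1) = 3)
    {N : Module.End ℂ (ℂ ⊗[ℚ] V)} (hN : N ∈ H.hodgeLieC) (hNP : ∀ p ∈ H.piece 1 0, N p = 0) (hNim : ∀ v, N v ∈ H.piece 1 0)
    {w₀ : ℂ ⊗[ℚ] V} (hw₀ : w₀ ∈ Module.End.eigenspace (φ.baseChange ℂ) μ ⊓ H.piece 0 1) (hw₀0 : w₀ ≠ 0) (hNw₀ : N w₀ = 0)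
    (hN0 : ∃ w ∈ Module.End.eigenspace (φ.baseChange ℂ) μ ⊓ H.piece 0 1, N w ≠ 0)
    (hr2 : ∀ B ∈ H.hodgeLieC, (∀ p ∈ H.piece 1 0, B p = 0) → (∀ v, B v ∈ H.piece 1 0) →
      (∃ u : ℂ ⊗[ℚ] V, ∀ w ∈ Module.End.eigenspace (φ.baseChange ℂ) μ ⊓ H.piece 0 1, B w ∈ ℂ ∙ u) →
      ∀ w ∈ Module.End.eigenspace (φ.baseChange ℂ) μ ⊓ H.piece 0 1, B w = 0) :
    ∀ F : Module.End ℂ ↥(Module.End.eigenspace (φ.baseChange ℂ) μ ⊓ H.piece 0 1),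
      ∃ Y ∈ H.hodgeLieC, (∀ p ∈ H.piece 1 0, Y p ∈ H.piece 1 0) ∧ (∀ q ∈ H.piece 0 1, Y q ∈ H.piece 0 1) ∧
        ∀ w : ↥(Module.End.eigenspace (φ.baseChange ℂ) μ ⊓ H.piece 0 1), Y w = F w := by
  classical
  obtain ⟨M, hMconj⟩ := exists_conjOp N
  obtain ⟨lam, hlam0, hM𝔥, hMQ, hMim, hMWp, -, hRlam, hNWm, -, hker⟩ :=
    WeilSquare.exists_eigenvalue_of_rankTwo H hn heff ψ hφE hd hμ hWp hWm hN hNP hNim hw₀ hw₀0 hNw₀ hN0 hr2 hMconj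
  subst hn
  obtain ⟨Θ, hΘ⟩ := exists_hodgeTheta H
  obtain ⟨hPmem, hQmem, hΘ10, hΘ01, -⟩ := UnitaryTheta.theta_facts H rfl heff hΘ
  have hΘ𝔥 : Θ ∈ H.hodgeLieC := H.mem_hodgeLieC_of_forall_piece hΘ
  set Wp := Module.End.eigenspace (φ.baseChange ℂ) μ ⊓ H.piece 1 0 with hWpdef
  set Wm := Module.End.eigenspace (φ.baseChange ℂ) μ ⊓ H.piece 0 1 with hWmdef
  -- `Y₀' := −[M, N] − λΘ`
  set R' := M * N - N * M with hR'def
  set Y₀ := -R' - lam • Θ with hY₀def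
  have hR'𝔥 : R' ∈ H.hodgeLieC := H.commutator_mem_hodgeLieC hM𝔥 hN
  have hY₀𝔥 : Y₀ ∈ H.hodgeLieC := Submodule.sub_mem _ (Submodule.neg_mem _ hR'𝔥) (Submodule.smul_mem _ _ hΘ𝔥)
  have hR'q : ∀ q ∈ H.piece 0 1, R' q = M (N q) := fun q hq => by
    rw [hR'def, LinearMap.sub_apply, Module.End.mul_apply, Module.End.mul_apply, hMQ q hq, map_zero, sub_zero]
  have hY₀P : ∀ p ∈ H.piece 1 0, Y₀ p ∈ H.piece 1 0 := fun p hp => by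
    rw [hY₀def, LinearMap.sub_apply, LinearMap.neg_apply, LinearMap.smul_apply, hΘ10 p hp, hR'def, LinearMap.sub_apply,
      Module.End.mul_apply, Module.End.mul_apply, hNP p hp, map_zero, zero_sub, neg_neg]
    exact Submodule.sub_mem _ (hNim _) (Submodule.smul_mem _ _ hp)
  have hY₀Q : ∀ q ∈ H.piece 0 1, Y₀ q ∈ H.piece 0 1 := fun q hq => by
    rw [hY₀def, LinearMap.sub_apply, LinearMap.neg_apply, LinearMap.smul_apply, hΘ01 q hq, hR'q q hq]
    exact Submodule.sub_mem _ (Submodule.neg_mem _ (hMim _)) (Submodule.smul_mem _ _ (Submodule.neg_mem _ hq))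
  -- `M N w − λ w ∈ ℂ w₀` for `w ∈ W⁻`
  have hline : ∀ w ∈ Wm, M (N w) - lam • w ∈ ℂ ∙ w₀ := by
    intro w hw
    have hmem : M (N w) - lam • w ∈ Wm := Submodule.sub_mem _ (hMWp _ (hNWm w hw)) (Submodule.smul_mem _ _ hw)
    refine hker _ hmem ?_
    rw [map_sub, map_smul, hRlam w hw, sub_self]
  obtain ⟨γ, hγ⟩ := WeilSquare.exists_dual_of_mapsTo_span (T := M * N - lam • 1) (S := Wm) hw₀0 (fun w hw => by
    rw [LinearMap.sub_apply, Module.End.mul_apply, LinearMap.smul_apply, Module.End.one_apply]; exact hline w hw)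
  have hγ' : ∀ w : Wm, M (N w) - lam • (w : ℂ ⊗[ℚ] V) = γ w • w₀ := fun w => by
    have h := hγ w
    rwa [LinearMap.sub_apply, Module.End.mul_apply, LinearMap.smul_apply, Module.End.one_apply] at h
  have hγw₀ : γ ⟨w₀, hw₀⟩ = -lam := by
    have h := hγ' ⟨w₀, hw₀⟩
    simp only at h
    rw [hNw₀, map_zero, zero_sub, ← neg_smul] at h
    exact ((smul_left_injective ℂ hw₀0) h).symm ▸ rfl
  -- `Y₀ w = −(MNw − λw)·… = −γ(w) w₀` on `W⁻`
  refine WeilSquare.exists_restrict_minus_eq_of_smulRight H rfl heff ψ hφE hd hφ2 hE hμ hY₀𝔥 hY₀P hY₀Q (-γ) ⟨w₀, hw₀⟩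
    (by rw [LinearMap.neg_apply, hγw₀, neg_neg]; exact hlam0) fun w => ?_
  have hw := (Submodule.mem_inf.1 w.2).2
  rw [hY₀def, LinearMap.sub_apply, LinearMap.neg_apply, LinearMap.smul_apply, hΘ01 _ hw, hR'q _ hw, LinearMap.neg_apply, neg_smul,
    smul_neg, sub_neg_eq_add, ← hγ' w]
  abel

end HodgeStructure

end Literature.AlgebraicGeometry.Motives

end
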